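import Summits.CriticalPhenomena.PercolationContinuityZ3.Theorems.PercNearOneGluingNoHeavyLowerTailSahiCddDefs
import Literature.Probability.Percolation.ConditionalPositiveAssociationProofs
import Literature.Probability.LatticeModels.ProdBernoulliIndependence
import Mathlib.Tactic.Ring
import Mathlib.Tactic.Linarith
import HarnessLib

/-!
# cdd theorem, part 1/4: pivot identities for `T = E₃(1_U,·,·)` and the defect `D` along a free coordinate

Support file (prover prim-ineq-prove-3 gen 13; `--supports stmt-CriticalPhenomena-4575`; memo
`run/shared/lean/prim/prim-ineq-prove-3/FINDING-G13-CDD-THEOREM.md` §2).  No definitions, no named facts, no sorries.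
Objects from `…SahiCddDefs` (`orEvent`, `cddT`, `cddD`).  Proved here (all elementary):
* `ex_split` — pivotal splitting of an expectation under the product weight along a coordinate `e`:
  `E φ = p_e E[φ(insert e ·)] + (1 − p_e) E[φ(· ∖ e)]` (from `BHK2006.blockFubini`);
* `cddD_eq`, `cddD_mul_sub`, `cddD_sub_mul_sub` — expansions of the linear functional `D(h) = E[(2·1_U − E1_U)h]`;
* `cddT_pivot` — **(2a)** `T(φ,ψ) = Σ_{y,y'} w_y w_{y'} T(φ^y,ψ^{y'}) + p_e q_e·D((φ¹−φ⁰)(ψ¹−ψ⁰))` for `e ∉ F`;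
* `cddD_pivot` — **(2b)** `D(h) = p_e D(h¹) + q_e D(h⁰)`.
-/

noncomputable section

namespace Summit.CriticalPhenomena.PercolationContinuityZ3.Theorems

namespace SahiCdd

open Literature.Combinatorics.Sahi2008
open Literature.Probability.Percolation.DecisionTree (ind ind_of_mem ind_of_not_mem ind_nonneg)
open Literature.Probability.Percolation.BHK2006 (weight weight_nonneg blockFubini harris)
open Literature.Probability.LatticeModels (prodBernoulli sahiE3 sahiE3_def)

variable {ι : Type*} [Fintype ι] [DecidableEq ι]

/-! ### Linear algebra of `ex` -/

omit [DecidableEq ι] in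
/-- `ex` respects pointwise equality. [folklore] -/
theorem ex_congr' {μ : Set ι → ℝ} {f g : Set ι → ℝ} (h : ∀ ω, f ω = g ω) : ex μ f = ex μ g := by
  unfold ex; exact Finset.sum_congr rfl fun ω _ => by rw [h ω]

omit [DecidableEq ι] in
/-- `ex` of a pointwise linear combination of two functions. [folklore] -/
theorem ex_lin2 (μ : Set ι → ℝ) (a b : ℝ) (f g : Set ι → ℝ) :
    ex μ (fun ω => a * f ω + b * g ω) = a * ex μ f + b * ex μ g := by
  unfold ex
  rw [Finset.mul_sum, Finset.mul_sum, ← Finset.sum_add_distrib]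
  exact Finset.sum_congr rfl fun ω _ => by ring

/-! ### The OR event -/

omit [Fintype ι] [DecidableEq ι] in
/-- Membership in the OR event is unaffected by a coordinate outside `F` (insertion). [folklore] -/
theorem insert_mem_orEvent_iff {F : Finset ι} {e : ι} (he : e ∉ F) (ω : Set ι) :
    insert e ω ∈ orEvent F ↔ ω ∈ orEvent F := by
  simp only [orEvent, Set.mem_setOf_eq, Set.mem_insert_iff]
  constructor
  · rintro ⟨i, hi, h | h⟩
    · exact absurd hi (h ▸ he)
    · exact ⟨i, hi, h⟩
  · rintro ⟨i, hi, h⟩; exact ⟨i, hi, Or.inr h⟩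

omit [Fintype ι] [DecidableEq ι] in
/-- Membership in the OR event is unaffected by a coordinate outside `F` (deletion). [folklore] -/
theorem sdiff_mem_orEvent_iff {F : Finset ι} {e : ι} (he : e ∉ F) (ω : Set ι) :
    ω \ {e} ∈ orEvent F ↔ ω ∈ orEvent F := by
  simp only [orEvent, Set.mem_setOf_eq, Set.mem_sdiff, Set.mem_singleton_iff]
  constructor
  · rintro ⟨i, hi, h, -⟩; exact ⟨i, hi, h⟩
  · rintro ⟨i, hi, h⟩; exact ⟨i, hi, h, fun h' => he (h' ▸ hi)⟩

omit [Fintype ι] [DecidableEq ι] in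
/-- The indicator of the OR event ignores insertion of a coordinate outside `F`. [folklore] -/
theorem ind_orEvent_insert {F : Finset ι} {e : ι} (he : e ∉ F) (ω : Set ι) :
    ind (orEvent F) (insert e ω) = ind (orEvent F) ω := by
  by_cases h : ω ∈ orEvent F
  · rw [ind_of_mem h, ind_of_mem ((insert_mem_orEvent_iff he ω).2 h)]
  · rw [ind_of_not_mem h, ind_of_not_mem (fun h' => h ((insert_mem_orEvent_iff he ω).1 h'))]

omit [Fintype ι] [DecidableEq ι] in
/-- The indicator of the OR event ignores deletion of a coordinate outside `F`. [folklore] -/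
theorem ind_orEvent_sdiff {F : Finset ι} {e : ι} (he : e ∉ F) (ω : Set ι) :
    ind (orEvent F) (ω \ {e}) = ind (orEvent F) ω := by
  by_cases h : ω ∈ orEvent F
  · rw [ind_of_mem h, ind_of_mem ((sdiff_mem_orEvent_iff he ω).2 h)]
  · rw [ind_of_not_mem h, ind_of_not_mem (fun h' => h ((sdiff_mem_orEvent_iff he ω).1 h'))]

/-! ### One-coordinate splitting of expectations under the product weight -/

omit [DecidableEq ι] in
/-- The mass of `{e ∈ ω}` under the product weight is `p e`. [folklore] -/
theorem ex_ind_mem (p : ι → unitInterval) (e : ι) :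
    ex (bernoulliWeight p) (ind {ω : Set ι | e ∈ ω}) = p e := by
  rw [ex_bernoulliWeight_ind]; exact Literature.Probability.LatticeModels.prodBernoulli_real_setOf_mem p e

omit [DecidableEq ι] in
/-- The mass of `{e ∉ ω}` under the product weight is `1 − p e`. [folklore] -/
theorem ex_ind_notMem (p : ι → unitInterval) (e : ι) :
    ex (bernoulliWeight p) (ind {ω : Set ι | e ∉ ω}) = 1 - p e := by
  rw [ex_bernoulliWeight_ind]; exact Literature.Probability.LatticeModels.prodBernoulli_real_setOf_notMem p e

/-- **Pivotal splitting of an expectation**: `E φ = p_e E[φ(insert e ·)] + (1 − p_e) E[φ(· ∖ {e})]`. [folklore] -/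
theorem ex_split (p : ι → unitInterval) (e : ι) (φ : Set ι → ℝ) :
    ex (bernoulliWeight p) φ =
      (p e : ℝ) * ex (bernoulliWeight p) (fun ω => φ (insert e ω)) +
        (1 - p e) * ex (bernoulliWeight p) (fun ω => φ (ω \ {e})) := by
  classical
  have hsum : ∑ ω, bernoulliWeight p ω = 1 := sum_bernoulliWeight p
  have hF := blockFubini (fun i => (p i : ℝ)) ({e}ᶜ : Set ι) (fun a b => φ (a ∪ b))
  -- left side of blockFubini is `E φ`
  have hL : ∀ ω : Set ι, φ (ω ∩ {e}ᶜ ∪ ω \ {e}ᶜ) = φ ω := fun ω => by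
    congr 1; ext i; by_cases hi : i = e <;> simp [hi]
  simp only [hL] at hF
  change (∑ ω, bernoulliWeight p ω) * ex (bernoulliWeight p) φ = _ at hF
  rw [hsum, one_mul] at hF
  rw [hF]
  -- evaluate the inner sum
  have hinner : ∀ ω : Set ι, (∑ ω', bernoulliWeight p ω' * φ (ω ∩ {e}ᶜ ∪ ω' \ {e}ᶜ)) =
      (p e : ℝ) * φ (insert e ω) + (1 - p e) * φ (ω \ {e}) := by
    intro ω
    have hpt : ∀ ω' : Set ι, bernoulliWeight p ω' * φ (ω ∩ {e}ᶜ ∪ ω' \ {e}ᶜ) =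
        bernoulliWeight p ω' * (φ (insert e ω) * ind {ω'' : Set ι | e ∈ ω''} ω' +
          φ (ω \ {e}) * ind {ω'' : Set ι | e ∉ ω''} ω') := by
      intro ω'
      by_cases he : e ∈ ω'
      · have h1 : ω ∩ {e}ᶜ ∪ ω' \ {e}ᶜ = insert e ω := by
          ext i; by_cases hi : i = e <;> simp [hi, he]
        rw [h1, ind_of_mem (show ω' ∈ {ω'' : Set ι | e ∈ ω''} from he),
          ind_of_not_mem (show ω' ∉ {ω'' : Set ι | e ∉ ω''} from fun h => h he)]
        ring
      · have h1 : ω ∩ {e}ᶜ ∪ ω' \ {e}ᶜ = ω \ {e} := by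
          ext i; by_cases hi : i = e <;> simp [hi, he]
        rw [h1, ind_of_not_mem (show ω' ∉ {ω'' : Set ι | e ∈ ω''} from he),
          ind_of_mem (show ω' ∈ {ω'' : Set ι | e ∉ ω''} from he)]
        ring
    rw [Finset.sum_congr rfl fun ω' _ => hpt ω']
    have := ex_lin2 (bernoulliWeight p) (φ (insert e ω)) (φ (ω \ {e}))
      (ind {ω'' : Set ι | e ∈ ω''}) (ind {ω'' : Set ι | e ∉ ω''})
    unfold ex at this
    rw [this]
    have h1 := ex_ind_mem p e
    have h2 := ex_ind_notMem p e
    unfold ex at h1 h2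
    rw [h1, h2]; ring
  rw [Finset.sum_congr rfl fun ω _ => by rw [hinner ω]]
  have := ex_lin2 (bernoulliWeight p) (p e : ℝ) (1 - p e) (fun ω => φ (insert e ω)) (fun ω => φ (ω \ {e}))
  unfold ex at this ⊢
  rw [← this]


omit [DecidableEq ι] in
/-- `ex` of a pointwise linear combination of four functions. [folklore] -/
theorem ex_lin4 (μ : Set ι → ℝ) (a b c d : ℝ) (f g h k : Set ι → ℝ) :
    ex μ (fun ω => a * f ω + b * g ω + c * h ω + d * k ω) = a * ex μ f + b * ex μ g + c * ex μ h + d * ex μ k := by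
  unfold ex
  rw [Finset.mul_sum, Finset.mul_sum, Finset.mul_sum, Finset.mul_sum, ← Finset.sum_add_distrib,
    ← Finset.sum_add_distrib, ← Finset.sum_add_distrib]
  exact Finset.sum_congr rfl fun ω _ => by ring

/-! ### The defect functional `D`: expansion lemmas -/

omit [DecidableEq ι] in
/-- `D(h) = 2E[1_U h] − E[1_U]·E[h]`. [this work] -/
theorem cddD_eq (p : ι → unitInterval) (F : Finset ι) (h : Set ι → ℝ) :
    cddD p F h = 2 * ex (bernoulliWeight p) (ind (orEvent F) * h) -
      ex (bernoulliWeight p) (ind (orEvent F)) * ex (bernoulliWeight p) h := by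
  unfold cddD
  rw [ex_congr' (fun ω => show (2 * ind (orEvent F) ω - ex (bernoulliWeight p) (ind (orEvent F))) * h ω =
      2 * (ind (orEvent F) * h) ω + (- ex (bernoulliWeight p) (ind (orEvent F))) * h ω from by
        simp only [Pi.mul_apply]; ring), ex_lin2]
  ring

omit [DecidableEq ι] in
/-- `D` on a product `φ·(ψ − χ)`. [this work] -/
theorem cddD_mul_sub (p : ι → unitInterval) (F : Finset ι) (φ ψ χ : Set ι → ℝ) :
    cddD p F (fun ω => φ ω * (ψ ω - χ ω)) =
      2 * (ex (bernoulliWeight p) (ind (orEvent F) * φ * ψ) - ex (bernoulliWeight p) (ind (orEvent F) * φ * χ)) -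
        ex (bernoulliWeight p) (ind (orEvent F)) *
          (ex (bernoulliWeight p) (φ * ψ) - ex (bernoulliWeight p) (φ * χ)) := by
  rw [cddD_eq]
  have h1 : ex (bernoulliWeight p) (ind (orEvent F) * fun ω => φ ω * (ψ ω - χ ω)) =
      ex (bernoulliWeight p) (ind (orEvent F) * φ * ψ) - ex (bernoulliWeight p) (ind (orEvent F) * φ * χ) := by
    rw [ex_congr' (fun ω => show (ind (orEvent F) * fun ω => φ ω * (ψ ω - χ ω)) ω =
      1 * (ind (orEvent F) * φ * ψ) ω + (-1) * (ind (orEvent F) * φ * χ) ω from by simp only [Pi.mul_apply]; ring), ex_lin2]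
    ring
  have h2 : ex (bernoulliWeight p) (fun ω => φ ω * (ψ ω - χ ω)) =
      ex (bernoulliWeight p) (φ * ψ) - ex (bernoulliWeight p) (φ * χ) := by
    rw [ex_congr' (fun ω => show φ ω * (ψ ω - χ ω) = 1 * (φ * ψ) ω + (-1) * (φ * χ) ω from by
      simp only [Pi.mul_apply]; ring), ex_lin2]
    ring
  rw [h1, h2]

omit [DecidableEq ι] in
/-- `D` on a product of differences `(φ − φ')·(ψ − ψ')`. [this work] -/
theorem cddD_sub_mul_sub (p : ι → unitInterval) (F : Finset ι) (φ φ' ψ ψ' : Set ι → ℝ) :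
    cddD p F (fun ω => (φ ω - φ' ω) * (ψ ω - ψ' ω)) =
      2 * (ex (bernoulliWeight p) (ind (orEvent F) * φ * ψ) - ex (bernoulliWeight p) (ind (orEvent F) * φ * ψ')
          - ex (bernoulliWeight p) (ind (orEvent F) * φ' * ψ) + ex (bernoulliWeight p) (ind (orEvent F) * φ' * ψ')) -
        ex (bernoulliWeight p) (ind (orEvent F)) *
          (ex (bernoulliWeight p) (φ * ψ) - ex (bernoulliWeight p) (φ * ψ')
            - ex (bernoulliWeight p) (φ' * ψ) + ex (bernoulliWeight p) (φ' * ψ')) := by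
  rw [cddD_eq]
  have h1 : ex (bernoulliWeight p) (ind (orEvent F) * fun ω => (φ ω - φ' ω) * (ψ ω - ψ' ω)) =
      ex (bernoulliWeight p) (ind (orEvent F) * φ * ψ) - ex (bernoulliWeight p) (ind (orEvent F) * φ * ψ')
        - ex (bernoulliWeight p) (ind (orEvent F) * φ' * ψ) + ex (bernoulliWeight p) (ind (orEvent F) * φ' * ψ') := by
    rw [ex_congr' (fun ω => show (ind (orEvent F) * fun ω => (φ ω - φ' ω) * (ψ ω - ψ' ω)) ω =
      1 * (ind (orEvent F) * φ * ψ) ω + (-1) * (ind (orEvent F) * φ * ψ') ω + (-1) * (ind (orEvent F) * φ' * ψ) ω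
        + 1 * (ind (orEvent F) * φ' * ψ') ω from by simp only [Pi.mul_apply]; ring), ex_lin4]
    ring
  have h2 : ex (bernoulliWeight p) (fun ω => (φ ω - φ' ω) * (ψ ω - ψ' ω)) =
      ex (bernoulliWeight p) (φ * ψ) - ex (bernoulliWeight p) (φ * ψ') - ex (bernoulliWeight p) (φ' * ψ)
        + ex (bernoulliWeight p) (φ' * ψ') := by
    rw [ex_congr' (fun ω => show (φ ω - φ' ω) * (ψ ω - ψ' ω) =
      1 * (φ * ψ) ω + (-1) * (φ * ψ') ω + (-1) * (φ' * ψ) ω + 1 * (φ' * ψ') ω from by simp only [Pi.mul_apply]; ring), ex_lin4]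
    ring
  rw [h1, h2]

/-! ### Pivot identities along a coordinate outside `F` -/

/-- Splitting of `E[1_U·φ·ψ]` along `e ∉ F`. [this work] -/
theorem ex_indU_mul_mul_split (p : ι → unitInterval) {F : Finset ι} {e : ι} (he : e ∉ F) (φ ψ : Set ι → ℝ) :
    ex (bernoulliWeight p) (ind (orEvent F) * φ * ψ) =
      (p e : ℝ) * ex (bernoulliWeight p) (ind (orEvent F) * (fun ω => φ (insert e ω)) * (fun ω => ψ (insert e ω))) +
        (1 - p e) * ex (bernoulliWeight p) (ind (orEvent F) * (fun ω => φ (ω \ {e})) * (fun ω => ψ (ω \ {e}))) := by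
  rw [ex_split p e]
  congr 2
  · exact ex_congr' fun ω => by simp only [Pi.mul_apply, ind_orEvent_insert he]
  · exact ex_congr' fun ω => by simp only [Pi.mul_apply, ind_orEvent_sdiff he]

/-- Splitting of `E[1_U·φ]` along `e ∉ F`. [this work] -/
theorem ex_indU_mul_split (p : ι → unitInterval) {F : Finset ι} {e : ι} (he : e ∉ F) (φ : Set ι → ℝ) :
    ex (bernoulliWeight p) (ind (orEvent F) * φ) =
      (p e : ℝ) * ex (bernoulliWeight p) (ind (orEvent F) * (fun ω => φ (insert e ω))) +
        (1 - p e) * ex (bernoulliWeight p) (ind (orEvent F) * (fun ω => φ (ω \ {e}))) := by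
  rw [ex_split p e]
  congr 2
  · exact ex_congr' fun ω => by simp only [Pi.mul_apply, ind_orEvent_insert he]
  · exact ex_congr' fun ω => by simp only [Pi.mul_apply, ind_orEvent_sdiff he]

/-- Splitting of `E[φ·ψ]` along `e`. [this work] -/
theorem ex_mul_split (p : ι → unitInterval) (e : ι) (φ ψ : Set ι → ℝ) :
    ex (bernoulliWeight p) (φ * ψ) =
      (p e : ℝ) * ex (bernoulliWeight p) ((fun ω => φ (insert e ω)) * (fun ω => ψ (insert e ω))) +
        (1 - p e) * ex (bernoulliWeight p) ((fun ω => φ (ω \ {e})) * (fun ω => ψ (ω \ {e}))) := by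
  rw [ex_split p e]; rfl

/-- **Pivot identity for `T`** along `e ∉ F`:
`T(φ,ψ) = Σ_{y,y'} w_y w_{y'} T(φ^y,ψ^{y'}) + p_e q_e·D((φ¹−φ⁰)(ψ¹−ψ⁰))`. [this work] -/
theorem cddT_pivot (p : ι → unitInterval) {F : Finset ι} {e : ι} (he : e ∉ F) (φ ψ : Set ι → ℝ) :
    cddT p F φ ψ =
      (p e : ℝ) ^ 2 * cddT p F (fun ω => φ (insert e ω)) (fun ω => ψ (insert e ω))
      + (1 - p e) ^ 2 * cddT p F (fun ω => φ (ω \ {e})) (fun ω => ψ (ω \ {e}))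
      + (p e : ℝ) * (1 - p e) * (cddT p F (fun ω => φ (insert e ω)) (fun ω => ψ (ω \ {e}))
          + cddT p F (fun ω => φ (ω \ {e})) (fun ω => ψ (insert e ω)))
      + (p e : ℝ) * (1 - p e) *
          cddD p F (fun ω => (φ (insert e ω) - φ (ω \ {e})) * (ψ (insert e ω) - ψ (ω \ {e}))) := by
  have h3 := ex_indU_mul_mul_split p he φ ψ
  have h2f := ex_indU_mul_split p he φ
  have h2g := ex_indU_mul_split p he ψ
  have hfg := ex_mul_split p e φ ψ
  have hf := ex_split p e φ
  have hg := ex_split p e ψ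
  have hD := cddD_sub_mul_sub p F (fun ω => φ (insert e ω)) (fun ω => φ (ω \ {e}))
    (fun ω => ψ (insert e ω)) (fun ω => ψ (ω \ {e}))
  unfold cddT
  rw [h3, h2f, h2g, hfg, hf, hg, hD]
  ring

/-- **Pivot identity for `D`** along `e ∉ F`: `D(h) = p_e D(h¹) + q_e D(h⁰)`. [this work] -/
theorem cddD_pivot (p : ι → unitInterval) {F : Finset ι} {e : ι} (he : e ∉ F) (h : Set ι → ℝ) :
    cddD p F h = (p e : ℝ) * cddD p F (fun ω => h (insert e ω)) + (1 - p e) * cddD p F (fun ω => h (ω \ {e})) := by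
  rw [cddD_eq, cddD_eq, cddD_eq, ex_indU_mul_split p he h, ex_split p e h]
  ring

end SahiCdd

end Summit.CriticalPhenomena.PercolationContinuityZ3.Theorems
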